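import Summits.BirchSwinnertonDyer.Rank1Residual.GaloisImage.ThreeAdicTowerInertiaCount
import Literature.NumberTheory.EllipticCurves.SerreOpenImageDeterminantProofs
import Summits.BirchSwinnertonDyer.Rank1Residual.GaloisImage.GL2F3NormalizerOrderThree
import Literature.NumberTheory.GaloisRepresentations.TameInertiaCharacterGlobalProofs
import Mathlib.RingTheory.Ideal.Quotient.HasFiniteQuotients
import HarnessLib

/-!
# Inertia at `3` on `E[3]`: an image of order divisible by `3` has order dividing `6`; hence
# `4 ∣ e₃ ⟹ 3 ∤ e₃` (cell `b2b-bsdres`, team n1011, row T-b9 'tame tower at `3`' — §5c of the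
# generic layer, seat p02)

HONEST FRAMING (cell `b2b-bsdres`, run/shared/lean/b2b/bsd-rank1-residual/, verbatim in every
file): the goal of the cell is to DELETE the COMBINATION-SHAPED residual classes of the
Birch–Swinnerton-Dyer formula for ALL analytic-rank `≤ 1` elliptic curves over `ℚ` — "full BSD
formula for every rank `≤ 1` curve in class `C`" assembled STRICTLY from published theorems — so
that the rank-`≤ 1` remainder becomes exactly the CONSTRUCTION-SHAPED classes, which are TYPED
(missing-input `Prop`s), NOT attempted. This is not "finishing BSD". Research route; theorems
only (no definition, no named fact); nothing is booked by this file; no label changes.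

## What this file proves

Let `E = W/ℚ` be an elliptic curve, `𝔓` a prime of `\bar ℤ` over `3`, `I_𝔓 ≤ Γ_ℚ` its inertia
group and `e₃ := #ρ̄_{E,3}(I_𝔓)`.

* `not_three_dvd_card_inertia_map_galoisRepTorsion_three_of_four_dvd` — **`4 ∣ e₃ ⟹ 3 ∤ e₃`.**
  Proof: `ρ̄_{E,3}(I_𝔓) ≅ G₀`, the inertia group of `𝔓 ∩ ℚ(E[3])` in `Gal(ℚ(E[3])/ℚ)` (Hilbert
  theory, `inertia_comap_eq_map_absRestrictNormalHom`); by the TAME CHARACTER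
  (`Literature/…/TameInertiaCharacterGlobalProofs.lean`: `#G₀ = #G₁ · m`, `m ∣ 3^f − 1`, `G₀/G₁`
  cyclic, `G₁ ⊴ G₀`) and `G₁` a `3`-group (`isPGroup_three_ramificationSubgroup_one`), if
  `12 ∣ e₃` then `#G₁ = 3`, `G₁ = ⟨t⟩`, and a generator `g` of `G₀ mod G₁` normalises `⟨t⟩`;
  transported into `Aut(E[3]) ≅ GL₂(𝔽₃)` (frame `exists_frame_galoisRepTorsion_rat`) the lemma
  `GL2F3.sq_eq_of_normalizes_of_injective` gives `g² ∈ G₁`, so `G₀ = G₁ ∪ gG₁` has at most `6`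
  elements — contradiction.
* CASE B of row T-b9 then reads: `ρ̄_{E,3}` onto, a `9`-torsion abscissa `x` with
  `v(x)^d = v(3)^b`, `9 ∣ d`, and `4 ∣ e₃` (from a `3`-torsion abscissa of valuation `1/4` via
  `dvd_card_inertia_map_galoisRepTorsion_of_valuation_X_pow_eq`) ⟹ the `3`-adic tower, by
  `forall_hasSurjectiveModNGaloisRep_three_pow_of_surj_of_valuation_X_pow_eq_of_not_three_dvd`
  (`GaloisImage/ThreeAdicTowerInertiaCriterion.lean`) fed with the theorem below; the packaged
  one-liner lives in the sibling `GaloisImage/ThreeTorsionInertiaTameTower.lean`.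

References: [SerreLocalFields1979] Ch. IV §2 Prop. 7, Cor. 1 and Cor. 3; [Serre1972] §4.1;
[SerreAbelianLadic1968] IV-23 Lemma 3.
-/

noncomputable section

open scoped Classical NumberField Pointwise
open Field IsDedekindDomain WeierstrassCurve

-- As in `Wuthrich2014/ThreeAdicImageSupersingularProofs` / part 1: pin `Algebra ℚ ℚ̄` to
-- `AlgebraicClosure.instAlgebra`; `Subsingleton (Algebra ℚ _)`, nothing overridden in substance.
attribute [local instance 1001] IntermediateField.algebra'
attribute [local instance 1002] AlgebraicClosure.instAlgebra

namespace Summit.BirchSwinnertonDyer.Rank1Residual.GaloisImage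

open Literature.NumberTheory.EllipticCurves Literature.NumberTheory.GaloisRepresentations
  Rat.HeightOneSpectrum

section Tame

variable {W : WeierstrassCurve ℚ} [W.IsElliptic]

/-- Two homomorphisms with the same kernel identify the same pairs of elements. [folklore] -/
private theorem apply_eq_iff_of_ker_eq {G H₁ H₂ : Type*} [Group G] [Group H₁] [Group H₂]
    (f₁ : G →* H₁) (f₂ : G →* H₂) (h : f₁.ker = f₂.ker) (x y : G) : f₁ x = f₁ y ↔ f₂ x = f₂ y := by
  constructor
  · intro hxy
    have hmem : x⁻¹ * y ∈ f₂.ker := by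
      rw [← h, MonoidHom.mem_ker, map_mul, map_inv, hxy, inv_mul_cancel]
    rwa [MonoidHom.mem_ker, map_mul, map_inv, inv_mul_eq_one] at hmem
  · intro hxy
    have hmem : x⁻¹ * y ∈ f₁.ker := by
      rw [h, MonoidHom.mem_ker, map_mul, map_inv, hxy, inv_mul_cancel]
    rwa [MonoidHom.mem_ker, map_mul, map_inv, inv_mul_eq_one] at hmem

/-- In a group, an element of the cyclic subgroup generated by an element of order `3` is
`1`, `t` or `t²`. [folklore] -/
private theorem eq_of_mem_zpowers_of_orderOf_three {G : Type*} [Group G] {t τ : G}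
    (ht : orderOf t = 3) (hτ : τ ∈ Subgroup.zpowers t) : τ = 1 ∨ τ = t ∨ τ = t ^ 2 := by
  obtain ⟨j, rfl⟩ := Subgroup.mem_zpowers_iff.mp hτ
  rw [← zpow_mod_orderOf, ht]
  have h0 : 0 ≤ j % (3 : ℕ) := Int.emod_nonneg _ (by norm_num)
  have h3 : j % (3 : ℕ) < 3 := Int.emod_lt_of_pos _ (by norm_num)
  obtain ⟨n, hn⟩ := Int.eq_ofNat_of_zero_le h0
  rw [hn] at h3 ⊢
  have hn3 : n < 3 := by exact_mod_cast h3
  rw [zpow_natCast]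
  interval_cases n
  · exact Or.inl (pow_zero t)
  · exact Or.inr (Or.inl (pow_one t))
  · exact Or.inr (Or.inr rfl)

/-- `3 ∈ v` and `3 ∉ v²` for the place `v` of `ℚ` at `3`. [folklore] -/
private theorem three_mem_and_not_mem_sq'' {v : HeightOneSpectrum (𝓞 ℚ)}
    (hv : (primesEquiv v : ℕ) = 3) :
    ((3 : ℕ) : 𝓞 ℚ) ∈ v.asIdeal ∧ ((3 : ℕ) : 𝓞 ℚ) ∉ v.asIdeal ^ 2 := by
  have hgen : natGenerator v = 3 := hv
  set e := Rat.IsIntegralClosure.intEquiv (𝓞 ℚ) with he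
  refine ⟨?_, ?_⟩
  · have h := (natGenerator_dvd_iff v).mp (dvd_refl (natGenerator v))
    rw [hgen] at h
    rwa [← map_natCast e, Ideal.apply_mem_of_equiv_iff] at h
  · intro h3
    have h' : e ((3 : ℕ) : 𝓞 ℚ) ∈ (v.asIdeal ^ 2).map e := Ideal.mem_map_of_mem _ h3
    rw [Ideal.map_pow, ← span_natGenerator, hgen, Ideal.span_singleton_pow, map_natCast,
      Ideal.mem_span_singleton] at h'
    norm_num at h'

/-- `#ρ̄_{E,3}(H) ∣ 48` (a frame `Aut(E[3]) ≅ GL₂(𝔽₃)`; private twin of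
`card_map_galoisRepTorsion_three_dvd` of `ThreeAdicTowerInertiaCriterion.lean`, kept here so that
this file does not depend on that one). [folklore] -/
private theorem card_map_galoisRepTorsion_three_dvd' (H : Subgroup (absoluteGaloisGroup ℚ)) :
    Nat.card (H.map (galoisRepTorsion W 3)) ∣ 48 := by
  haveI : Fact (Nat.Prime 3) := ⟨Nat.prime_three⟩
  obtain ⟨-, Φ, -, -, -, -, -⟩ := exists_frame_galoisRepTorsion_rat W 3
  have h48 : Nat.card (Multiplicative (AddAut (geomTorsion W ((3 : ℕ) : ℤ)))) = 48 := by
    rw [Nat.card_congr Φ.toEquiv, Matrix.card_GL_field, Fin.prod_univ_two, ZMod.card, Fin.val_zero,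
      Fin.val_one, pow_zero, pow_one]
    norm_num
  have h := Subgroup.card_subgroup_dvd_card (H.map (galoisRepTorsion W ((3 : ℕ) : ℤ)))
  rw [h48] at h
  exact_mod_cast h

/-- `0 < #ρ̄_{E,3}(H)` (private twin of `card_map_galoisRepTorsion_pos`). [folklore] -/
private theorem card_map_galoisRepTorsion_three_pos' (H : Subgroup (absoluteGaloisGroup ℚ)) :
    0 < Nat.card (H.map (galoisRepTorsion W 3)) := by
  haveI : NeZero (3 : ℕ) := ⟨by norm_num⟩
  set L := W.divisionField 3 with hL
  have hker : (absRestrictNormalHom L).ker = (galoisRepTorsion W 3).ker := by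
    ext σ
    simp only [MonoidHom.mem_ker]
    exact (W.absRestrictNormalHom_divisionField_eq_one_iff 3 σ).trans
      (galoisRepTorsion_eq_one_iff' W 3 σ).symm
  have hcardA : Nat.card (H.map (absRestrictNormalHom L)) =
      Nat.card (H.map (galoisRepTorsion W 3)) := by
    rw [← Subgroup.relIndex_ker, ← Subgroup.relIndex_ker, hker]
  rw [← hcardA]
  haveI : Finite (H.map (absRestrictNormalHom L)) := inferInstance
  exact Nat.card_pos

set_option maxHeartbeats 400000 in
/-- **`4 ∣ #ρ̄_{E,3}(I_𝔓) ⟹ 3 ∤ #ρ̄_{E,3}(I_𝔓)`** for the inertia group `I_𝔓 ≤ Γ_ℚ` of a prime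
`𝔓` of `\bar ℤ` over `3`: the inertia group of `𝔓 ∩ ℚ(E[3])` has a normal Sylow `3`-subgroup with
cyclic quotient of order prime to `3` (tame character), and in `GL₂(𝔽₃)` such a group of order
divisible by `3` has order dividing `6`. Equivalently: if `3 ∣ e₃` then `4 ∤ e₃`.
[cite: SerreLocalFields1979, Ch. IV §2 Prop. 7, Cor. 1 and Cor. 3] [cite: Serre1972, §4.1] -/
theorem not_three_dvd_card_inertia_map_galoisRepTorsion_three_of_four_dvd
    {v : HeightOneSpectrum (𝓞 ℚ)} (hv : (primesEquiv v : ℕ) = 3)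
    {𝔓 : Ideal (absIntegers (𝓞 ℚ) ℚ)} (h𝔓 : 𝔓 ∈ v.primesAbove)
    (h4 : 4 ∣ Nat.card ((𝔓.inertia (absoluteGaloisGroup ℚ)).map (galoisRepTorsion W 3))) :
    ¬ 3 ∣ Nat.card ((𝔓.inertia (absoluteGaloisGroup ℚ)).map (galoisRepTorsion W 3)) := by
  intro h3
  haveI : Fact (Nat.Prime 3) := ⟨Nat.prime_three⟩
  haveI : NeZero (3 : ℕ) := ⟨by norm_num⟩
  haveI : 𝔓.IsPrime := h𝔓.1
  haveI h𝔓max : 𝔓.IsMaximal := HeightOneSpectrum.isMaximal_of_mem_primesAbove h𝔓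
  -- the `3`-division field and the prime `P_L = 𝔓 ∩ 𝓞_L`
  set L := W.divisionField 3 with hL
  haveI : IsGalois ℚ L := inferInstance
  haveI hDD : IsDedekindDomain (integralClosure (𝓞 ℚ) L) :=
    integralClosure.isDedekindDomain (𝓞 ℚ) ℚ L
  haveI : IsFractionRing (integralClosure (𝓞 ℚ) L) L :=
    integralClosure.isFractionRing_of_finite_extension ℚ L
  set PL := 𝔓.comap (L.integralClosureToAbsIntegers (𝓞 ℚ)) with hPL
  haveI hPLmax : PL.IsMaximal := isMaximal_comap_integralClosureToAbsIntegers (𝓞 ℚ) 𝔓 L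
  obtain ⟨h3v, h3v2⟩ := three_mem_and_not_mem_sq'' hv
  have hunder : PL.under (𝓞 ℚ) = v.asIdeal := by
    rw [hPL, under_comap_integralClosureToAbsIntegers, ← h𝔓.2.over]
  have h3PL : algebraMap (𝓞 ℚ) (integralClosure (𝓞 ℚ) L) ((3 : ℕ) : 𝓞 ℚ) ∈ PL := by
    have : ((3 : ℕ) : 𝓞 ℚ) ∈ PL.under (𝓞 ℚ) := by rw [hunder]; exact h3v
    rwa [Ideal.under_def, Ideal.mem_comap] at this
  have h3N : ((3 : ℕ) : integralClosure (𝓞 ℚ) L) ∈ PL := by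
    have := h3PL; rwa [map_natCast] at this
  have h3S : (3 : integralClosure (𝓞 ℚ) L) ∈ PL := by simpa only [Nat.cast_ofNat] using h3N
  have hPL0 : PL ≠ ⊥ := by
    intro h0
    rw [h0, Ideal.mem_bot] at h3PL
    have hinj : Function.Injective (algebraMap (𝓞 ℚ) (integralClosure (𝓞 ℚ) L)) :=
      (faithfulSMul_iff_algebraMap_injective _ _).mp
        (faithfulSMul_integralClosure (𝓞 ℚ) (K := ℚ) (L := L))
    have h30 : ((3 : ℕ) : 𝓞 ℚ) = 0 := hinj (h3PL.trans (map_zero _).symm)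
    apply h3v2
    rw [h30]
    exact Submodule.zero_mem _
  -- residue fields: finite, separable, of characteristic `3`
  haveI : Finite ((𝓞 ℚ) ⧸ 𝔓.under (𝓞 ℚ)) := by
    rw [← h𝔓.2.over]; exact Ideal.finiteQuotientOfFreeOfNeBot v.asIdeal v.ne_bot
  haveI hsep : Algebra.IsSeparable ((𝓞 ℚ) ⧸ PL.under (𝓞 ℚ)) (integralClosure (𝓞 ℚ) L ⧸ PL) :=
    isSeparable_residue_comap (𝓞 ℚ) 𝔓 L
  haveI : Algebra.IsSeparable ℚ L := Algebra.IsSeparable.of_integral ℚ L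
  haveI : Module.Finite (𝓞 ℚ) (integralClosure (𝓞 ℚ) L) :=
    IsIntegralClosure.finite (𝓞 ℚ) ℚ L (integralClosure (𝓞 ℚ) L)
  haveI hfin : Finite (integralClosure (𝓞 ℚ) L ⧸ PL) :=
    (Ring.HasFiniteQuotients.of_module_finite (𝓞 ℚ) (integralClosure (𝓞 ℚ) L)).finiteQuotient hPL0
  -- the inertia group `G₀` and the wild inertia group `G₁` of `P_L`
  set G₀ := PL.inertia (L ≃ₐ[ℚ] L) with hG₀
  set G₁ := PL.ramificationSubgroup (L ≃ₐ[ℚ] L) 1 with hG₁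
  have hG₁le : G₁ ≤ G₀ := Ideal.ramificationSubgroup_le_inertia PL (L ≃ₐ[ℚ] L) 1
  have hG₁p : IsPGroup 3 G₁ := isPGroup_three_ramificationSubgroup_one (K := ℚ) PL h3S
  obtain ⟨g, hgG₀, hgen⟩ :=
    exists_generator_inertia_mod_ramificationSubgroup_one (K := ℚ) PL hPL0
  obtain ⟨m, hcard, hm⟩ := exists_card_inertia_eq_mul_dvd (K := ℚ) PL hPL0
  -- `#(𝓞_L / P_L) = 3^f`, so `3 ∤ m`
  have h3m : ¬ 3 ∣ m := by
    intro h3m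
    letI : Field (integralClosure (𝓞 ℚ) L ⧸ PL) := Ideal.Quotient.field PL
    letI := Fintype.ofFinite (integralClosure (𝓞 ℚ) L ⧸ PL)
    have h30 : ((3 : ℕ) : integralClosure (𝓞 ℚ) L ⧸ PL) = 0 := by
      rw [← map_natCast (Ideal.Quotient.mk PL), Ideal.Quotient.eq_zero_iff_mem]
      exact h3N
    haveI : CharP (integralClosure (𝓞 ℚ) L ⧸ PL) 3 :=
      (CharP.charP_iff_prime_eq_zero Nat.prime_three).mpr h30
    obtain ⟨n, -, hn⟩ := FiniteField.card (integralClosure (𝓞 ℚ) L ⧸ PL) 3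
    rw [Nat.card_eq_fintype_card, hn] at hm
    have h1 : 3 ∣ 3 ^ (n : ℕ) - 1 := h3m.trans hm
    have h2 : 3 ∣ 3 ^ (n : ℕ) := dvd_pow_self 3 (PNat.ne_zero n)
    have h3' : 3 ∣ 3 ^ (n : ℕ) - (3 ^ (n : ℕ) - 1) := Nat.dvd_sub h2 h1
    have hpos : 1 ≤ 3 ^ (n : ℕ) := Nat.one_le_pow _ _ (by norm_num)
    rw [Nat.sub_sub_self hpos] at h3'
    exact absurd h3' (by norm_num)
  -- `#ρ̄₃(I_𝔓) = #G₀` (Hilbert theory: `G₀ = I_𝔓|_L`, same kernel as `ρ̄₃`)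
  set I := 𝔓.inertia (absoluteGaloisGroup ℚ) with hI
  have hGI : G₀ = I.map (absRestrictNormalHom L) := by
    rw [hG₀, hPL]; exact inertia_comap_eq_map_absRestrictNormalHom (R := 𝓞 ℚ) 𝔓 L
  have hker : (absRestrictNormalHom L).ker = (galoisRepTorsion W 3).ker := by
    ext σ
    simp only [MonoidHom.mem_ker]
    exact (W.absRestrictNormalHom_divisionField_eq_one_iff 3 σ).trans
      (galoisRepTorsion_eq_one_iff' W 3 σ).symm
  have hcardA : Nat.card G₀ = Nat.card (I.map (galoisRepTorsion W 3)) := by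
    rw [hGI, ← Subgroup.relIndex_ker, ← Subgroup.relIndex_ker, hker]
  have htr : ∀ x y : absoluteGaloisGroup ℚ,
      absRestrictNormalHom L x = absRestrictNormalHom L y ↔
        galoisRepTorsion W 3 x = galoisRepTorsion W 3 y :=
    apply_eq_iff_of_ker_eq _ _ hker
  -- `12 ∣ #G₀`, `#G₀ ∣ 48`
  have h12 : 12 ∣ Nat.card G₀ := by
    rw [hcardA]; exact Nat.Coprime.mul_dvd_of_dvd_of_dvd (by norm_num : Nat.Coprime 4 3) h4 h3
  have h48 : Nat.card G₀ ∣ 48 := by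
    rw [hcardA]; exact card_map_galoisRepTorsion_three_dvd' (W := W) I
  have hG₀pos : 0 < Nat.card G₀ := by
    rw [hcardA]; exact card_map_galoisRepTorsion_three_pos' (W := W) I
  -- `#G₁ = 3`
  have hG₁card : Nat.card G₁ = 3 := by
    obtain ⟨k, hk⟩ := hG₁p.exists_card_eq
    have hdvd : Nat.card G₁ ∣ Nat.card G₀ := Subgroup.card_dvd_of_le hG₁le
    rw [hk] at hdvd ⊢
    have hk1 : k ≤ 1 := by
      by_contra hk1
      push Not at hk1
      have : 3 ^ 2 ∣ 48 := ((pow_dvd_pow 3 hk1).trans hdvd).trans h48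
      norm_num at this
    have hk0 : k ≠ 0 := by
      intro hk0
      rw [hk0, pow_zero] at hk
      rw [hk, one_mul] at hcard
      rw [hcard] at h12
      exact h3m ((dvd_refl 3).trans ((show 3 ∣ 12 by norm_num).trans h12))
    interval_cases k
    · exact absurd rfl hk0
    · rfl
  -- `G₁ = ⟨t⟩` with `t` of order `3`
  obtain ⟨t, htG₁, ht1⟩ : ∃ t ∈ G₁, t ≠ 1 := by
    by_contra hnone
    push Not at hnone
    have : G₁ = ⊥ := (Subgroup.eq_bot_iff_forall _).mpr hnone
    rw [this, Subgroup.card_bot] at hG₁card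
    norm_num at hG₁card
  haveI : Finite G₁ := Nat.finite_of_card_ne_zero (by rw [hG₁card]; norm_num)
  have htord : orderOf t = 3 := by
    have hdvd : orderOf t ∣ 3 := by
      rw [← hG₁card]
      exact Subgroup.orderOf_dvd_natCard G₁ htG₁
    rcases (Nat.dvd_prime Nat.prime_three).mp hdvd with h | h
    · exact absurd (orderOf_eq_one_iff.mp h) ht1
    · exact h
  have ht3 : t ^ 3 = 1 := by rw [← htord]; exact pow_orderOf_eq_one t
  have hzp : Subgroup.zpowers t = G₁ := by
    apply Subgroup.eq_of_le_of_card_ge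
    · exact (Subgroup.zpowers_le (G := L ≃ₐ[ℚ] L)).mpr htG₁
    · rw [hG₁card, Nat.card_zpowers, htord]
  have hG₁mem : ∀ τ ∈ G₁, τ = 1 ∨ τ = t ∨ τ = t ^ 2 := fun τ hτ ↦
    eq_of_mem_zpowers_of_orderOf_three htord (by rw [hzp]; exact hτ)
  -- `g` normalises `⟨t⟩`
  have hconjG : g * t * g⁻¹ = 1 ∨ g * t * g⁻¹ = t ∨ g * t * g⁻¹ = t ^ 2 :=
    hG₁mem _ (conj_mem_ramificationSubgroup_one_of_mem_inertia (K := ℚ) PL hgG₀ htG₁)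
  -- lift `g`, `t` to `Γ_ℚ` and read them on `E[3]`
  have hgmap : g ∈ I.map (absRestrictNormalHom L) := by rw [← hGI]; exact hgG₀
  have htmap : t ∈ I.map (absRestrictNormalHom L) := by rw [← hGI]; exact hG₁le htG₁
  obtain ⟨s, hsI, hs⟩ := Subgroup.mem_map.mp hgmap
  obtain ⟨r, hrI, hr⟩ := Subgroup.mem_map.mp htmap
  set φ₁ := absRestrictNormalHom L with hφ₁
  set φ₂ := galoisRepTorsion W 3 with hφ₂
  set h := φ₂ s with hh
  set u := φ₂ r with hu
  have hu3 : u ^ 3 = 1 := by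
    rw [hu, ← map_pow, ← map_one φ₂, ← htr, map_pow, map_one, hr, ht3]
  have hu1 : u ≠ 1 := by
    intro hu1'
    rw [hu, ← map_one φ₂, ← htr, map_one, hr] at hu1'
    exact ht1 hu1'
  have hconj : h * u * h⁻¹ = 1 ∨ h * u * h⁻¹ = u ∨ h * u * h⁻¹ = u ^ 2 := by
    rw [hh, hu, ← map_mul, ← map_inv, ← map_mul, ← map_pow, ← map_one φ₂, ← htr, ← htr, ← htr,
      map_one, map_pow, map_mul, map_mul, map_inv, hs, hr]
    exact hconjG
  -- the frame `Aut(E[3]) ≅ GL₂(𝔽₃)` and the `GL₂(𝔽₃)` lemma: `h² ∈ {1, u, u²}`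
  obtain ⟨-, Φ, -, -, -, -, -⟩ := exists_frame_galoisRepTorsion_rat W 3
  have hsq := GL2F3.sq_eq_of_normalizes_of_injective Φ.toMonoidHom Φ.injective h u hu3 hu1 hconj
  -- back in `Gal(L/ℚ)`: `g² ∈ G₁`
  have hg2 : g ^ 2 ∈ G₁ := by
    have key : g ^ 2 = 1 ∨ g ^ 2 = t ∨ g ^ 2 = t ^ 2 := by
      rw [← hs, ← hr, ← map_pow, ← map_pow, ← map_one φ₁, htr, htr, htr, map_pow, map_one,
        map_pow]
      exact hsq
    rcases key with h1 | h1 | h1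
    · rw [h1]; exact G₁.one_mem
    · rw [h1]; exact htG₁
    · rw [h1]; exact G₁.pow_mem htG₁ 2
  -- hence `G₀ = G₁ ∪ g G₁` has at most `6` elements
  let f : Bool × G₁ → G₀ := fun p ↦
    ⟨(if p.1 then g else 1) * (p.2 : L ≃ₐ[ℚ] L),
      G₀.mul_mem (by split_ifs; exacts [hgG₀, G₀.one_mem]) (hG₁le p.2.2)⟩
  have hf : Function.Surjective f := by
    rintro ⟨σ, hσ⟩
    obtain ⟨k, τ, hτ, hστ⟩ := hgen σ hσ
    have hk : g ^ k = g ^ (k % 2) * (g ^ 2) ^ (k / 2) := by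
      rw [← zpow_natCast, ← zpow_mul, ← zpow_add]
      congr 1
      push_cast
      omega
    have hmem : (g ^ 2) ^ (k / 2) * τ ∈ G₁ := G₁.mul_mem (G₁.zpow_mem hg2 _) hτ
    rcases Int.emod_two_eq_zero_or_one k with h0 | h1
    · refine ⟨(false, ⟨_, hmem⟩), Subtype.ext ?_⟩
      show (if false then g else 1) * ((g ^ 2) ^ (k / 2) * τ) = σ
      rw [hστ, hk, h0, zpow_zero, one_mul]
      simp
    · refine ⟨(true, ⟨_, hmem⟩), Subtype.ext ?_⟩
      show (if true then g else 1) * ((g ^ 2) ^ (k / 2) * τ) = σ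
      rw [hστ, hk, h1, zpow_one, mul_assoc]
      simp
  have hle : Nat.card G₀ ≤ Nat.card (Bool × G₁) := Nat.card_le_card_of_surjective f hf
  rw [Nat.card_prod, Nat.card_eq_fintype_card (α := Bool), Fintype.card_bool, hG₁card] at hle
  -- but `12 ∣ #G₀` and `#G₀ > 0`
  obtain ⟨c, hc⟩ := h12
  rw [hc] at hle hG₀pos
  omega

end Tame

end Summit.BirchSwinnertonDyer.Rank1Residual.GaloisImage

end
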